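import Literature.NumberTheory.EllipticCurves.Sprung2012.SharpFlatControlAtChar
import Literature.NumberTheory.EllipticCurves.PAdicBSD
import Literature.NumberTheory.EllipticCurves.QuadraticTwist
import Literature.NumberTheory.EllipticCurves.Rank1Residual.Predicates
import HarnessLib

/-!
# Cell `bsd-f1-sign2` (`p = 2`, non-CM) — analytic lens (seat `-an`) × typer: ♯/♭ CONTROL AND CORANK AT
# THE ORDER-2 CHARACTER `χ₈` (the (II)-half of AN-2 and the algebraic twins of AN-5):
# `SharpControlAtChi8`, `FlatCorankAtChi8`, `SharpCorankAtChi8`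

HONEST FRAMING (typer seat `bsd-f1-sign2-ty`; HOME `run/shared/lean/pub/bsd-f1-sign2/`, D-ty-1 of MEMO-an
§5; statement shapes fixed by the -an planner, STATUS 2026-08-27T15:56:17Z, over the typer's Literature
carrier `Sprung2012/SharpFlatControlAtChar.lean` (`SharpFlatControlAtNegTwo`, `SharpFlatCorankAtNegTwo`);
refuter trap REF1-CARRIERS-AT2 v1.5 **T16** applied: the chromatic dual Selmer datum `D` is PINNED by a
Honda system `IsHondaSystem κ (closureEmb …) W (W.frobeniusTrace 2) g cneg c`, `ap := W.frobeniusTrace 2`,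
`κ.IsCyclotomic`, a topological generator `γ` with the tree's variable convention (`κ.IsTopGenerator γ`,
`IsCyclotomicVariable 2 γ`; for the ORDER-2 character any generator gives `T = −2`), and the chroma is
explicit (♯ vs ♭ is exactly the AN-5 distinction) — binders copied from the tree template
`Sprung2012.thm714seq_sharpFlatColemanKato_zeta` with `p := 2` and its printed `p ≠ 2` guard DROPPED
(that is the point: these are `p = 2` statements). STATEMENTS ONLY — three `@[conjecture] def`s (OPEN
obligations of ours); nothing asserted, nothing booked, no named fact, PARTITION: none moved. In print every
control / corank statement for signed Selmer groups is `p` odd (Kobayashi 2003 Thm. 9.3; Sprung 2012 §7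
«assume p is odd»; REF2 MAP O1/O2): at `2` these are NOT in print.

WHAT THEY SAY (ℚ_∞ = cyclotomic `ℤ₂`-extension, `Λ = ℤ₂⟦T⟧`, `χ = χ₈ : γ ↦ −1`, `T ↦ −2`, `W₂` any model of
`W ⊗ χ₈`, `r₂ = r_an(W₂)`, `X^• = D.X` Sprung's •-dual Selmer module of `W` over ℚ_∞):
* `SharpControlAtChi8` (AN-2 (II)): `W` good supersingular at `2`, non-CM, `W₂` the MINIMAL model of
  `W ⊗ χ₈` with `r₂ = 0` ⇒ `X^♯/(T+2)` and `Sel_{2^∞}(W₂/ℚ)` are finite and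
  `#(X^♯/(T+2)) = 2^{1 + v₂ Tam(W₂)} · #Sel_{2^∞}(W₂/ℚ)` — -an's (II) «ord₂ #(X♯/(T+2)) = ord₂ #Sel_{2^∞}(W₂)
  + ord₂ ∏c(W₂) + 1» verbatim (local index `i_{χ₈} = 2` plus the Tamagawa term; no torsion term is owed:
  `GoodSS W 2` forces `E(ℚ)[2] = E^{(2)}(ℚ)[2] = 0`), the defect MEASURED by AN-2's bookkeeping
  `v₂θ₁(χ₈) = 1 + v₂(#Ш(W₂)·Tam(W₂)/#tors(W₂)²)` on 8/8 + 614/614 rows (`#tors = 1` on all, `v₂Tam ≥ 1` on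
  365/614). REF1-AUDIT §14b: the first typing with the bare exponent `e = 1` was NARROW (it dropped the
  Tamagawa term and contradicts the 365 rows under IMC♯); this is REF1's repair C′(a) = the planner's own
  (II); with it the statement additionally predicts `X^♯[T+2] = 0` (semisimplicity at `T + 2`);
* `SharpCorankAtChi8` / `FlatCorankAtChi8` (algebraic twins of AN-5 `BlindOrderAtChi8`, `a₂ = 0`): the
  `ℤ₂`-corank of `X^♯/(T+2)` is `r₂` and that of `X^♭/(T+2)` is `|r₂ − 1|` (♭ is blind at `χ₈`). Why they
  might fail (planner): non-semisimplicity of `X^•` at `T + 2` makes corank < order of vanishing.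

BC5 WITNESS: the analytic shadows — AN-2 bookkeeping 8/8 out of sample + 614/614 (`v₂θ − v₂q = 1`), AN-5
λ-shadow 813/813 with 0 violations (MEMO-an v1.2/v1.3, MEMO-an-data/an5_twistrank_out.json 5aea2fd6c7a0bb65);
no algebraic census exists (X^• at 2 has no engine). CHEAPEST FALSIFIER: a curve on the habitat with a
certified `2^∞`-Selmer computation of `W₂` contradicting the ♯-index `2` — none available. WHY NOVEL: MAP O1/O2
(signed Selmer groups at 2: definition transcribed, cotorsion/control not in print).

References: [Sprung2012] Def. 7.9/7.11, §7; [Kobayashi2003] Thm. 9.3; HOME MEMO-an.md §5 (D-ty-1),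
STATUS 2026-08-27T15:56:17Z, REF1-CARRIERS-AT2-v1.md v1.5 T16.
-/

set_option autoImplicit false

noncomputable section

open scoped Classical

open NumberField IsDedekindDomain WeierstrassCurve Literature.NumberTheory.EllipticCurves
  Literature.NumberTheory.GaloisRepresentations ZpExtension Literature.NumberTheory.EllipticCurves.Sprung2012
  Literature.NumberTheory.EllipticCurves.Sprung2017 Literature.NumberTheory.EllipticCurves.Rank1Residual

namespace Summit.BirchSwinnertonDyer.Rank1Residual.F1Sign2

/-- **`SharpControlAtChi8` (AN-2 (II); OPEN at 2):** for `W/ℚ` globally minimal, good supersingular at `2`,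
non-CM, the cyclotomic `ℤ₂`-extension `κ` with topological generator `γ` in the tree's variable convention,
a place `v ∣ 2`, a local generator lift `g`, a Honda system `(cneg, c)` for `a₂(W)` (T16 pins), Sprung's
♯-dual Selmer datum `D` of `W`, and the globally minimal model `W₂` of `W ⊗ χ₈` with `r_an(W₂) = 0`:
`#(X^♯/(T+2)) = 2^{1 + v₂ Tam(W₂)} · #Sel_{2^∞}(W₂/ℚ)`, both finite
(`SharpFlatControlAtNegTwo D W₂ (1 + padicValNat 2 W₂.tamagawaProduct)`; REF1 §14b repair C′(a) = MEMO-an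
§AN-2 (II)). [folklore] -/
@[conjecture] def SharpControlAtChi8 : Prop :=
  ∀ (W : WeierstrassCurve ℚ) [W.IsElliptic] [W.IsGloballyMinimal]
    (κ : ZpExtension ℚ 2) (γ : Field.absoluteGaloisGroup ℚ),
    GoodSS W 2 → ¬ W.HasCM →
    κ.IsCyclotomic → κ.IsTopGenerator γ → IsCyclotomicVariable 2 γ →
    ∀ (v : HeightOneSpectrum (𝓞 ℚ)), (2 : 𝓞 ℚ) ∈ v.asIdeal →
    ∀ (g : Field.absoluteGaloisGroup (v.adicCompletion ℚ)),
      κ.IsTopGenerator (resGalOfEmb (closureEmb (K := ℚ) (v.adicCompletion ℚ)) g) →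
    ∀ (cneg : localPoints W (v.adicCompletion ℚ)) (c : ℕ → localPoints W (v.adicCompletion ℚ)),
      IsHondaSystem κ (closureEmb (K := ℚ) (v.adicCompletion ℚ)) W (W.frobeniusTrace 2) g cneg c →
    ∀ (D : SharpFlatSelmerDualData W κ γ (closureEmb (K := ℚ) (v.adicCompletion ℚ))
        (W.frobeniusTrace 2) g c Chroma.sharp)
      (W₂ : WeierstrassCurve ℚ) [W₂.IsElliptic] [W₂.IsGloballyMinimal],
      (∃ C : WeierstrassCurve.VariableChange ℚ, C • W.quadraticTwist 2 = W₂) →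
      W₂.analyticRank = 0 →
      SharpFlatControlAtNegTwo D W₂ (1 + padicValNat 2 W₂.tamagawaProduct)

/-- **`SharpCorankAtChi8` (algebraic ♯-twin of AN-5; OPEN at 2):** same pins, `a₂(W) = 0`, any model `W₂`
of `W ⊗ χ₈`: the `ℤ₂`-corank of `X^♯/(T+2)` is `r_an(W₂)` (`SharpFlatCorankAtNegTwo D (W₂.analyticRank)`).
[folklore] -/
@[conjecture] def SharpCorankAtChi8 : Prop :=
  ∀ (W : WeierstrassCurve ℚ) [W.IsElliptic] [W.IsGloballyMinimal]
    (κ : ZpExtension ℚ 2) (γ : Field.absoluteGaloisGroup ℚ),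
    GoodSS W 2 → W.frobeniusTrace 2 = 0 →
    κ.IsCyclotomic → κ.IsTopGenerator γ → IsCyclotomicVariable 2 γ →
    ∀ (v : HeightOneSpectrum (𝓞 ℚ)), (2 : 𝓞 ℚ) ∈ v.asIdeal →
    ∀ (g : Field.absoluteGaloisGroup (v.adicCompletion ℚ)),
      κ.IsTopGenerator (resGalOfEmb (closureEmb (K := ℚ) (v.adicCompletion ℚ)) g) →
    ∀ (cneg : localPoints W (v.adicCompletion ℚ)) (c : ℕ → localPoints W (v.adicCompletion ℚ)),
      IsHondaSystem κ (closureEmb (K := ℚ) (v.adicCompletion ℚ)) W (W.frobeniusTrace 2) g cneg c →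
    ∀ (D : SharpFlatSelmerDualData W κ γ (closureEmb (K := ℚ) (v.adicCompletion ℚ))
        (W.frobeniusTrace 2) g c Chroma.sharp)
      (W₂ : WeierstrassCurve ℚ) [W₂.IsElliptic],
      (∃ C : WeierstrassCurve.VariableChange ℚ, C • W.quadraticTwist 2 = W₂) →
      SharpFlatCorankAtNegTwo D W₂.analyticRank

/-- **`FlatCorankAtChi8` (algebraic ♭-twin of AN-5; OPEN at 2):** same pins, `a₂(W) = 0`, any model `W₂`
of `W ⊗ χ₈`: the `ℤ₂`-corank of `X^♭/(T+2)` is `|r_an(W₂) − 1|` — ♭ is BLIND at `χ₈` (corank `1` at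
`r₂ = 0`, dropping to `r₂ − 1` for `r₂ ≥ 1`) (`SharpFlatCorankAtNegTwo D ((r₂ − 1).natAbs)`). [folklore] -/
@[conjecture] def FlatCorankAtChi8 : Prop :=
  ∀ (W : WeierstrassCurve ℚ) [W.IsElliptic] [W.IsGloballyMinimal]
    (κ : ZpExtension ℚ 2) (γ : Field.absoluteGaloisGroup ℚ),
    GoodSS W 2 → W.frobeniusTrace 2 = 0 →
    κ.IsCyclotomic → κ.IsTopGenerator γ → IsCyclotomicVariable 2 γ →
    ∀ (v : HeightOneSpectrum (𝓞 ℚ)), (2 : 𝓞 ℚ) ∈ v.asIdeal →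
    ∀ (g : Field.absoluteGaloisGroup (v.adicCompletion ℚ)),
      κ.IsTopGenerator (resGalOfEmb (closureEmb (K := ℚ) (v.adicCompletion ℚ)) g) →
    ∀ (cneg : localPoints W (v.adicCompletion ℚ)) (c : ℕ → localPoints W (v.adicCompletion ℚ)),
      IsHondaSystem κ (closureEmb (K := ℚ) (v.adicCompletion ℚ)) W (W.frobeniusTrace 2) g cneg c →
    ∀ (D : SharpFlatSelmerDualData W κ γ (closureEmb (K := ℚ) (v.adicCompletion ℚ))
        (W.frobeniusTrace 2) g c Chroma.flat)
      (W₂ : WeierstrassCurve ℚ) [W₂.IsElliptic],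
      (∃ C : WeierstrassCurve.VariableChange ℚ, C • W.quadraticTwist 2 = W₂) →
      SharpFlatCorankAtNegTwo D (((W₂.analyticRank : ℤ) - 1).natAbs)

end Summit.BirchSwinnertonDyer.Rank1Residual.F1Sign2

end
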